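import Summits.ResolutionOfSingularities.ResolutionOfSingularities.Theorems.FrobeniusLadderFInjectiveMacaulayficationFilteredReesConeClause
import Summits.ResolutionOfSingularities.ResolutionOfSingularities.Theorems.FrobeniusLadderFInjectiveMacaulayficationGradedChartClauseAssembly
import Mathlib.RingTheory.Noetherian.Basic
import HarnessLib

/-!
# (F4d) THE FILTERED CHART CORE: `chartClause_core_affine` instantiated at `B := T′♮`, `b := s̄/1`, `hclB :=` (F4c)
# (crux `FInjectiveMacaulayfication`, line `graded-engine` §17 filtered engine G4♮ — CRUX-PLAN v6 §1.2, the continuation body of (F6))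

Support file for crux stmt-ResolutionOfSingularities-15315 (`FrobeniusLadder.FInjectiveMacaulayfication`), chain w45a,
seat res-L1-w45a-stub-3. [OURS · L1 W4.5a] — NOT a statement of the manuscript; AI-written, weaker than expert review.

stub-4's (F6) recipe (STATUS 03:02:24Z) is `filteredReesInterface … ι♮ ū hιu _ (fun A′ _ ρ hρ hsN T _ ι′ e heN =>`
`chartClause_core_affine p k T′♮ A′ ρ hρ (s̄/1) N hsN hclB C_v T ι′ e ū heN Q huQ)` «modulo stub-3's (F4) instances and hclB; derive
`[IsNoetherianRing T] [CharP T p]` inside the continuation from `C_v` via `ι′`». This file IS that continuation body with everything of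
stub-3's side discharged: `filteredChartClause_core` takes the interface data `(A′, ρ, hρ, N, hsN, T, ι′, e, heN)` for the carrier
`T′♮ = Localization.Away (x̄_v^c)` over `ℛ = k[X,s]/(f^h)`, an arbitrary Noetherian chart ring `C₀` of characteristic `p` with `ι′ : C₀ ≃+* T`
and `u₀ ∈ Q` maximal, and the G4♮ hypotheses (`hfh`, `hD0`, `f₀ ≠ 0`, `(f)` prime, `x̄ⱼ ≠ 0`, `0 < c`, `hoff₀`), and returns the clause of
`(C₀)_Q` — by `GradedChartClauseAssembly.chartClause_core_affine` (p483269) fed with (F4b) `FilteredReesDomain` (domain / finite type /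
`CharP`) and (F4c) `FilteredReesConeClause.filteredRees_hclB'`. So (F6) = `filteredReesInterface … (filteredChartClause_core …)` once (F2) `ι♮`
is in. No definitions, no named facts; glue only. [folklore]
-/

-- single-problem summit: the doubled namespace component is forced
set_option linter.dupNamespace false

noncomputable section

namespace Summit.ResolutionOfSingularities.ResolutionOfSingularities.Theorems.FInjectiveMacaulayfication.FilteredReesChartCore

open Summit.ResolutionOfSingularities.ResolutionOfSingularities.Theorems.FInjectiveMacaulayfication

/-- **(F4d) The filtered chart core.** For the carrier `T′♮ = k[X,s]/(f^h)[1/x̄_v^c]` of the filtered engine and ANY interface data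
`(A′ ⊆ T′♮` integral with retraction `ρ`, `(s̄/1)^N ∈ A′`, `e : T[Y,Y⁻¹] ≃ A′`, `ι′ : C₀ ≃ T`, `e⁻¹((s̄/1)^N) ∈ (C(ι′ u₀)/1)`): the clause holds
at every maximal `Q ∋ u₀` of the (Noetherian, characteristic-`p`) chart ring `C₀`, given only the G4♮ hypotheses and `hoff₀`. [folklore] -/
theorem filteredChartClause_core (p : ℕ) [Fact p.Prime] (k : Type) [Field k] [CharP k p] (n : ℕ) (w : Fin n → ℕ) (D : ℕ)
    (f : MvPolynomial (Fin n) k) (fh : MvPolynomial (Option (Fin n)) k)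
    (hfh : fh = ∑ b ∈ f.support, MvPolynomial.monomial
      (Finsupp.mapDomain some b + Finsupp.single none (Finsupp.weight w b - D)) (MvPolynomial.coeff b f))
    (hD0 : ∀ m < D, MvPolynomial.weightedHomogeneousComponent w m f = 0)
    (f₀ : MvPolynomial (Fin n) k) (hf₀ : f₀ = MvPolynomial.weightedHomogeneousComponent w D f) (hD : f₀ ≠ 0)
    (hfprime : (Ideal.span {f}).IsPrime) (hXne : ∀ j : Fin n, Ideal.Quotient.mk (Ideal.span {f}) (MvPolynomial.X j) ≠ 0)
    (v : Fin n) (c : ℕ) (hc : 0 < c)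
    (hoff₀ : ∀ (Q : Ideal (MvPolynomial (Fin n) k ⧸ Ideal.span {f₀})) [Q.IsMaximal],
      (∃ j : Fin n, Ideal.Quotient.mk (Ideal.span {f₀}) (MvPolynomial.X j) ∉ Q) →
      ∀ d : ℕ, ringKrullDim (Localization.AtPrime Q) = d → ∀ t : Fin d → Localization.AtPrime Q,
        (Ideal.span (Set.range t)).radical.IsMaximal →
          RingTheory.Sequence.IsWeaklyRegular (Localization.AtPrime Q) (List.ofFn t) ∧
          ∀ y : Localization.AtPrime Q, (∃ e : ℕ, y ^ p ^ e ∈ Ideal.span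
            ((fun z : Localization.AtPrime Q => z ^ p ^ e) ''
              (Ideal.span (Set.range t) : Set (Localization.AtPrime Q)))) → y ∈ Ideal.span (Set.range t))
    (A' : Subalgebra k (Localization.Away (Ideal.Quotient.mk (Ideal.span {fh}) (MvPolynomial.X (some v)) ^ c))) [Algebra.IsIntegral A' (Localization.Away (Ideal.Quotient.mk (Ideal.span {fh}) (MvPolynomial.X (some v)) ^ c))] (ρ : (Localization.Away (Ideal.Quotient.mk (Ideal.span {fh}) (MvPolynomial.X (some v)) ^ c)) →ₗ[A'] A') (hρ : ∀ x : A', ρ (x : Localization.Away (Ideal.Quotient.mk (Ideal.span {fh}) (MvPolynomial.X (some v)) ^ c)) = x)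
    (N : ℕ) (hsN : (algebraMap (MvPolynomial (Option (Fin n)) k ⧸ Ideal.span {fh}) (Localization.Away (Ideal.Quotient.mk (Ideal.span {fh}) (MvPolynomial.X (some v)) ^ c)) (Ideal.Quotient.mk (Ideal.span {fh}) (MvPolynomial.X none))) ^ N ∈ A')
    (C₀ : Type) [CommRing C₀] [IsNoetherianRing C₀] [CharP C₀ p] (T : Type) [CommRing T] (ι' : C₀ ≃+* T)
    (e : Localization.Away (Polynomial.X : Polynomial T) ≃+* A') (u₀ : C₀)
    (heN : e.symm ⟨_, hsN⟩ ∈ Ideal.span {algebraMap (Polynomial T) (Localization.Away (Polynomial.X : Polynomial T))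
      (Polynomial.C (ι' u₀))})
    (Q : Ideal C₀) [Q.IsMaximal] (huQ : u₀ ∈ Q) :
    ∀ d : ℕ, ringKrullDim (Localization.AtPrime Q) = d → ∀ t : Fin d → Localization.AtPrime Q,
        (Ideal.span (Set.range t)).radical.IsMaximal →
          RingTheory.Sequence.IsWeaklyRegular (Localization.AtPrime Q) (List.ofFn t) ∧
          ∀ y : Localization.AtPrime Q, (∃ e : ℕ, y ^ p ^ e ∈ Ideal.span
            ((fun z : Localization.AtPrime Q => z ^ p ^ e) ''
              (Ideal.span (Set.range t) : Set (Localization.AtPrime Q)))) → y ∈ Ideal.span (Set.range t) := by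
  have hD' : MvPolynomial.weightedHomogeneousComponent w D f ≠ 0 := hf₀ ▸ hD
  haveI := FilteredReesDomain.isDomain_reesAway w D f fh hfh hD0 hD' hfprime hXne v c
  haveI := FilteredReesDomain.charP_reesAway p w D f fh hfh hD0 hD' hfprime hXne v c
  haveI : IsNoetherianRing T := isNoetherianRing_of_ringEquiv C₀ ι'
  haveI : CharP T p := charP_of_injective_ringHom (f := ι'.toRingHom) ι'.injective p
  exact GradedChartClauseAssembly.chartClause_core_affine p k (Localization.Away (Ideal.Quotient.mk (Ideal.span {fh}) (MvPolynomial.X (some v)) ^ c)) A' ρ hρ _ N hsN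
    (FilteredReesConeClause.filteredRees_hclB' p k n w D f fh hfh hD0 f₀ hf₀ hD hfprime hXne v c hc hoff₀) C₀ T ι' e u₀ heN Q huQ

end Summit.ResolutionOfSingularities.ResolutionOfSingularities.Theorems.FInjectiveMacaulayfication.FilteredReesChartCore

end
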